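import Summits.BirchSwinnertonDyer.BirchSwinnertonDyer.Theorems.ManinLocalTwoThreeTwistDefectRootCurves
import Summits.BirchSwinnertonDyer.BirchSwinnertonDyer.Theorems.ManinLocalTwoThreeEtaParity

/-!
# THE DEFECT LAW OF THE TWIST GROUPOID, part 7: ROOT-DATUM and η-PARITY CAPSTONES (cell bsd-f2-manin, desc g46 MEMO-desc §71 §12 and
§13 D–F, TURNKEY T-desc-58 FINAL sha16 ea245f8823aa6498; landed by p1 gen 25)

§12: (I1) and (I2) discharged from the TREE for a root carrying a datum (`cuspCoeff_eq_zero_of_datum_of_four_dvd`,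
`abs_maninConstant_eq_one_{oneTwelve,oneFortyFourB,oneSeventySixC,fourThirtyTwoB}_of_rootDatum`, `not_dvd_maninConstant_oneTwelve_of_rootDatum`,
`not_dvd_maninConstant_oneTwentyEightBD_of_rootDatum`); §D–§F: SIGN-FREE capstones with (I2) from η-parity
(`Theorems.ManinLocalTwoThreeEtaParity`): `abs_maninConstant_eq_one_oneTwelveB/A/oneFortyFourB_of_eta`, `not_dvd_maninConstant_oneTwelve_of_eta`, the form-identity interface `not_dvd_maninConstant_oneTwelve_of_charTwist` /
`abs_maninConstant_eq_one_oneFortyFourB_of_charTwist` (input: a level-112 / level-144 pinning as a `charTwist`), and `128b/128d` DATUM-FREE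
`not_dvd_maninConstant_oneTwentyEightBD_of_eta`.  The typed family Props (E-desc-242/243/244/245) and their instances are in part 8
(`…TwistDefectRootFamilies`).  No named fact; C2, Manin's conjecture and BSD NOT proved.
[cite: Stevens1989, Lemma (5.2) p. 96, Lemma (5.4) p. 97, (5.6)–(5.7) p. 98] [cite: Pal2012, Prop. 2.4, Lemma 3.1]
[cite: Connell1999, §5.7.3] [cite: SilvermanAEC2009, Cor. VII.7.2, §C.16] [cite: SilvermanATAEC1994, Cor. IV.9.1] [cite: EdixhovenManin1991, Prop. 2]
-/

set_option autoImplicit false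
-- the summit-side namespace `Summit.BirchSwinnertonDyer.BirchSwinnertonDyer.…` is the tree's (summit = sub-problem)
set_option linter.dupNamespace false

noncomputable section

open scoped Classical NumberField MatrixGroups ModularForm

namespace Summit.BirchSwinnertonDyer.BirchSwinnertonDyer.Theorems.ManinLocalTwoThree.TwistDefect

open WeierstrassCurve CongruenceSubgroup IsDedekindDomain IsDedekindDomain.HeightOneSpectrum Rat.HeightOneSpectrum
  Literature.NumberTheory.Automorphic Literature.NumberTheory.EllipticCurves Literature.NumberTheory.EllipticCurves.ModularForms
  Literature.NumberTheory.LFunctions.PrimitiveQuadratic Summit.BirchSwinnertonDyer.BirchSwinnertonDyer.Theorems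
  Summit.BirchSwinnertonDyer.BirchSwinnertonDyer.Theorems.ManinLocalTwoThree Summit.BirchSwinnertonDyer.Rank1Residual.ManinAdditive
  Summit.BirchSwinnertonDyer.BirchSwinnertonDyer.Theorems.ManinLocalTwoThree.TwistFamilies
  Summit.BirchSwinnertonDyer.BirchSwinnertonDyer.Theorems.ManinLocalTwoThree.AdditiveTwistFamilies
  Summit.BirchSwinnertonDyer.BirchSwinnertonDyer.Theorems.ManinLocalTwoThree.EtaParity

/-! ## §12 ROOT-DATUM CAPSTONES: (I1) and (I2) discharged from the TREE — only the twisted coefficient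
relation to a ROOT DATUM remains (E-desc-244)

For a complete root level `M` (p3/p2 fact-free pinning `f_apply_eq_*` + squeeze `periodLatticeLe_*`) and ANY
`X₀(M)`-datum `D₀` on a globally minimal `W₀`: `a₂ₖ(D₀.f) = 0` (the root curve is additive at `2` because
`4 ∣ M`, `KatoCurve.additive_of_sq_dvd_level`), and the squeeze applies to `D₀.f`.  Hence: member datum `D`
with `aₙ(D.f) = χ(n)·aₙ(D₀.f)` (odd `n`) ⟹ `|c(D)| = 1`.  Root data exist under the item's own binder
`exists_isNewformOf` (p3 `NonVacuity*`: `nonempty_modularParametrizationData_of_isNewformOf`). -/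

/-- `a₂ₖ(D₀.f) = 0` for every `X₀(M)`-datum with `4 ∣ M` (the curve is additive at `2`). [cite: Silverman1994, IV.9 Table 4.1] -/
theorem cuspCoeff_eq_zero_of_datum_of_four_dvd (W₀ : WeierstrassCurve ℚ) [W₀.IsElliptic] [W₀.IsGloballyMinimal]
    {M : ℕ} [NeZero M] (h4M : 4 ∣ M) (D₀ : ModularParametrizationData W₀ M) (n : ℕ) (hn : 2 ∣ n) :
    cuspCoeff D₀.f n = 0 := by
  haveI : Fact (Nat.Prime 2) := ⟨Nat.prime_two⟩
  have hadd : ¬ W₀.HasGoodReductionAtPrime 2 ∧ ¬ W₀.HasMultiplicativeReductionAtPrime 2 :=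
    KatoCurve.additive_of_sq_dvd_level 2 W₀ D₀.f D₀.isNewformOf
      (by rw [show (2 : ℕ) ^ 2 = 4 by norm_num]; exact h4M)
  rw [D₀.isNewformOf.2 n, W₀.LFunction_apply_eq_zero_of_not_good_of_not_mult 2 hadd.1 hadd.2 hn]
  simp

/-- **112 from a ROOT DATUM at 56 (E-desc-244 instance; both classes at once).**  For every `X₀(56)`-datum `D₀`
(on any globally minimal `W₀`) and every lattice-optimal `X₀(112)`-datum `D` with `aₙ(D.f) = χ₋₄(n)·aₙ(D₀.f)`
at odd `n`: `|c(D)| = 1`.  Proof: `D₀.f = P − Q ∨ P + Q` (p2/p3 `f_apply_eq_fiftySix`), `a₂ₖ(D₀.f) = 0`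
(`cuspCoeff_eq_zero_of_datum_of_four_dvd`), p3's squeezes `periodLatticeLe_fiftySixA/B`, then §10.
[cite: AgasheRibetStein2006, §§1–2] [cite: CremonaAlgorithms1997, Table 1 (56a1, 56b1, 112a1, 112b1)] -/
theorem abs_maninConstant_eq_one_oneTwelve_of_rootDatum (W₀ : WeierstrassCurve ℚ) [W₀.IsElliptic]
    [W₀.IsGloballyMinimal] (D₀ : ModularParametrizationData W₀ 56)
    (W : WeierstrassCurve ℚ) [W.IsElliptic] [W.IsGloballyMinimal] (D : ModularParametrizationData W 112)
    (hf : ∀ n : ℕ, ¬ 2 ∣ n → cuspCoeff D.f n = (ZMod.χ₄ n : ℂ) * cuspCoeff D₀.f n)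
    (hopt : ∀ z ∈ D.L.lattice, ∃ w ∈ periodLattice D.f, z = D.c * w) :
    |D.maninConstant| = 1 := by
  have heven := cuspCoeff_eq_zero_of_datum_of_four_dvd W₀ ⟨14, rfl⟩ D₀
  rcases NewformPinningFiftySix.f_apply_eq_fiftySix D₀ with h | h
  · exact abs_maninConstant_eq_one_oneTwelveB_of_cuspCoeff D₀.f
      (EtaIdentitiesFiftySix.periodLatticeLe_fiftySixA D₀.f h) heven W D hf hopt
  · exact abs_maninConstant_eq_one_oneTwelveA_of_cuspCoeff D₀.f
      (EtaIdentityKFiftySix.periodLatticeLe_fiftySixB D₀.f h) heven W D hf hopt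

/-- `2 ∤ c ∧ 3 ∤ c` on `X₀(112)` in the same situation. -/
theorem not_dvd_maninConstant_oneTwelve_of_rootDatum (W₀ : WeierstrassCurve ℚ) [W₀.IsElliptic]
    [W₀.IsGloballyMinimal] (D₀ : ModularParametrizationData W₀ 56)
    (W : WeierstrassCurve ℚ) [W.IsElliptic] [W.IsGloballyMinimal] (D : ModularParametrizationData W 112)
    (hf : ∀ n : ℕ, ¬ 2 ∣ n → cuspCoeff D.f n = (ZMod.χ₄ n : ℂ) * cuspCoeff D₀.f n)
    (hopt : ∀ z ∈ D.L.lattice, ∃ w ∈ periodLattice D.f, z = D.c * w) :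
    ¬ (2 : ℤ) ∣ D.maninConstant ∧ ¬ (3 : ℤ) ∣ D.maninConstant := by
  have h := abs_maninConstant_eq_one_oneTwelve_of_rootDatum W₀ D₀ W D hf hopt
  refine ⟨fun h2 ↦ ?_, fun h3 ↦ ?_⟩
  · have := Int.le_of_dvd (by rw [h]; norm_num) ((dvd_abs _ _).mpr h2)
    rw [h] at this
    norm_num at this
  · have := Int.le_of_dvd (by rw [h]; norm_num) ((dvd_abs _ _).mpr h3)
    rw [h] at this
    norm_num at this

/-- **144b from a ROOT DATUM at 72.** [cite: AgasheRibetStein2006, §§1–2] [cite: CremonaAlgorithms1997, Table 1 (72a1, 144b1)] -/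
theorem abs_maninConstant_eq_one_oneFortyFourB_of_rootDatum (W₀ : WeierstrassCurve ℚ) [W₀.IsElliptic]
    [W₀.IsGloballyMinimal] (D₀ : ModularParametrizationData W₀ 72)
    (W : WeierstrassCurve ℚ) [W.IsElliptic] [W.IsGloballyMinimal] (D : ModularParametrizationData W 144)
    (hf : ∀ n : ℕ, ¬ 2 ∣ n → cuspCoeff D.f n = (ZMod.χ₄ n : ℂ) * cuspCoeff D₀.f n)
    (hopt : ∀ z ∈ D.L.lattice, ∃ w ∈ periodLattice D.f, z = D.c * w) :
    |D.maninConstant| = 1 :=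
  abs_maninConstant_eq_one_oneFortyFourB_of_cuspCoeff D₀.f
    (EtaIdentitiesSeventyTwo.periodLatticeLe_seventyTwo D₀.f (NewformSeventyTwo.f_apply_eq_phi72 D₀))
    (cuspCoeff_eq_zero_of_datum_of_four_dvd W₀ ⟨18, rfl⟩ D₀) W D hf hopt

/-- **176c from a ROOT DATUM at 44.** [cite: AgasheRibetStein2006, §§1–2] [cite: CremonaAlgorithms1997, Table 1 (44a1, 176c1)] -/
theorem abs_maninConstant_eq_one_oneSeventySixC_of_rootDatum (W₀ : WeierstrassCurve ℚ) [W₀.IsElliptic]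
    [W₀.IsGloballyMinimal] (D₀ : ModularParametrizationData W₀ 44)
    (W : WeierstrassCurve ℚ) [W.IsElliptic] [W.IsGloballyMinimal] (D : ModularParametrizationData W 176)
    (hf : ∀ n : ℕ, ¬ 2 ∣ n → cuspCoeff D.f n = (ZMod.χ₄ n : ℂ) * cuspCoeff D₀.f n)
    (hopt : ∀ z ∈ D.L.lattice, ∃ w ∈ periodLattice D.f, z = D.c * w) :
    |D.maninConstant| = 1 :=
  abs_maninConstant_eq_one_oneSeventySixC_of_cuspCoeff D₀.f
    (LevelFortyFour.periodLatticeLe_fortyFour D₀.f (RatioBridge.f_ne_zero D₀) (LevelFortyFour.f_apply_eq_phi44 D₀))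
    (cuspCoeff_eq_zero_of_datum_of_four_dvd W₀ ⟨11, rfl⟩ D₀) W D hf hopt

/-- **432b from a ROOT DATUM at 108.** [cite: AgasheRibetStein2006, §§1–2] [cite: CremonaAlgorithms1997, Table 1 (108a1, 432b1)] -/
theorem abs_maninConstant_eq_one_fourThirtyTwoB_of_rootDatum (W₀ : WeierstrassCurve ℚ) [W₀.IsElliptic]
    [W₀.IsGloballyMinimal] (D₀ : ModularParametrizationData W₀ 108)
    (W : WeierstrassCurve ℚ) [W.IsElliptic] [W.IsGloballyMinimal] (D : ModularParametrizationData W 432)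
    (hf : ∀ n : ℕ, ¬ 2 ∣ n → cuspCoeff D.f n = (ZMod.χ₄ n : ℂ) * cuspCoeff D₀.f n)
    (hopt : ∀ z ∈ D.L.lattice, ∃ w ∈ periodLattice D.f, z = D.c * w) :
    |D.maninConstant| = 1 :=
  abs_maninConstant_eq_one_fourThirtyTwoB_of_cuspCoeff D₀.f
    (EtaIdentitiesOneHundredEight.periodLatticeLe_oneHundredEight D₀.f (LevelOneHundredEight.f_apply_eq_phi108 D₀))
    (cuspCoeff_eq_zero_of_datum_of_four_dvd W₀ ⟨27, rfl⟩ D₀) W D hf hopt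

/-- **128b / 128d from a ROOT DATUM at 128 in the class `128a`** ((I2) discharged; (I1) = p3's
`EtaIdentitiesOneTwentyEightA.periodLatticeLe_oneTwentyEight D₀.f h₀` from the pinned `η`-expression `h₀` of `D₀.f`).
[cite: AgasheRibetStein2006, §§1–2] [cite: CremonaAlgorithms1997, Table 1 (128a1, 128b1, 128d1)] -/
theorem not_dvd_maninConstant_oneTwentyEightBD_of_rootDatum (W₀ : WeierstrassCurve ℚ) [W₀.IsElliptic]
    [W₀.IsGloballyMinimal] (D₀ : ModularParametrizationData W₀ 128)
    (hLa : ∃ L₁ : PeriodPair, L₁.g₂ = -8 / 3 ∧ L₁.g₃ = -80 / 27 ∧ ∀ z ∈ periodLattice D₀.f, z ∈ L₁.lattice)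
    (W : WeierstrassCurve ℚ) [W.IsElliptic] [W.IsGloballyMinimal] (D : ModularParametrizationData W 128)
    (hf : (∀ n : ℕ, ¬ 2 ∣ n → cuspCoeff D.f n = (ZMod.χ₈' n : ℂ) * cuspCoeff D₀.f n) ∨
      (∀ n : ℕ, ¬ 2 ∣ n → cuspCoeff D.f n = (ZMod.χ₈ n : ℂ) * cuspCoeff D₀.f n))
    (hopt : ∀ z ∈ D.L.lattice, ∃ w ∈ periodLattice D.f, z = D.c * w) :
    ¬ (2 : ℤ) ∣ D.maninConstant ∧ ¬ (3 : ℤ) ∣ D.maninConstant :=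
  not_dvd_maninConstant_oneTwentyEightBD_of_cuspCoeff D₀.f hLa
    (cuspCoeff_eq_zero_of_datum_of_four_dvd W₀ ⟨32, rfl⟩ D₀) W D hf hopt

/-! ## §D  SIGN-FREE level-112 / 144 capstones: the ONLY remaining input is the twisted coefficient identity `hf` -/

/-- **112b, sign-free and datum-free (E-desc-245 instance):** for every `φ ∈ S₂(Γ₀(56))` with `⇑φ = P − Q` and every
lattice-optimal `X₀(112)`-datum `D` with `aₙ(D.f) = χ₋₄(n)·aₙ(φ)` at odd `n`: `|c(D)| = 1` — (I1) = p3
`periodLatticeLe_fiftySixA`, (I2) = `cuspCoeff_eq_zero_fiftySixA` (η-parity), transport = §10.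
[cite: AgasheRibetStein2006, §§1–2] [cite: CremonaAlgorithms1997, Table 3 (N = 56)] -/
theorem abs_maninConstant_eq_one_oneTwelveB_of_eta (φ : CuspForm (Gamma0 56) 2)
    (hφ : ⇑φ = fun τ ↦ etaQuotient 56 (expFn [(2, -1), (4, 3), (14, 3), (28, -1)]) τ
        - etaQuotient 56 (expFn [(2, 3), (4, -1), (14, -1), (28, 3)]) τ)
    (W : WeierstrassCurve ℚ) [W.IsElliptic] [W.IsGloballyMinimal] (D : ModularParametrizationData W 112)
    (hf : ∀ n : ℕ, ¬ 2 ∣ n → cuspCoeff D.f n = (ZMod.χ₄ n : ℂ) * cuspCoeff φ n)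
    (hopt : ∀ z ∈ D.L.lattice, ∃ w ∈ periodLattice D.f, z = D.c * w) :
    |D.maninConstant| = 1 :=
  abs_maninConstant_eq_one_oneTwelveB_of_cuspCoeff φ (EtaIdentitiesFiftySix.periodLatticeLe_fiftySixA φ hφ)
    (cuspCoeff_eq_zero_fiftySixA φ hφ) W D hf hopt

/-- **112a, sign-free and datum-free.** [cite: AgasheRibetStein2006, §§1–2] [cite: CremonaAlgorithms1997, Table 3 (N = 56)] -/
theorem abs_maninConstant_eq_one_oneTwelveA_of_eta (ψ : CuspForm (Gamma0 56) 2)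
    (hψ : ⇑ψ = fun τ ↦ etaQuotient 56 (expFn [(2, -1), (4, 3), (14, 3), (28, -1)]) τ
        + etaQuotient 56 (expFn [(2, 3), (4, -1), (14, -1), (28, 3)]) τ)
    (W : WeierstrassCurve ℚ) [W.IsElliptic] [W.IsGloballyMinimal] (D : ModularParametrizationData W 112)
    (hf : ∀ n : ℕ, ¬ 2 ∣ n → cuspCoeff D.f n = (ZMod.χ₄ n : ℂ) * cuspCoeff ψ n)
    (hopt : ∀ z ∈ D.L.lattice, ∃ w ∈ periodLattice D.f, z = D.c * w) :
    |D.maninConstant| = 1 :=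
  abs_maninConstant_eq_one_oneTwelveA_of_cuspCoeff ψ (EtaIdentityKFiftySix.periodLatticeLe_fiftySixB ψ hψ)
    (cuspCoeff_eq_zero_fiftySixB ψ hψ) W D hf hopt

/-- **144b, sign-free and datum-free.** [cite: AgasheRibetStein2006, §§1–2] [cite: CremonaAlgorithms1997, Table 3 (N = 72)] -/
theorem abs_maninConstant_eq_one_oneFortyFourB_of_eta (φ : CuspForm (Gamma0 72) 2)
    (hφ : ⇑φ = fun τ ↦ (2 / 3 : ℂ) * etaQuotient 72 (expFn [(2, -2), (4, 4), (6, 2)]) τ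
        + (1 / 3 : ℂ) * etaQuotient 72 (expFn [(2, 4), (4, -2), (12, 2)]) τ)
    (W : WeierstrassCurve ℚ) [W.IsElliptic] [W.IsGloballyMinimal] (D : ModularParametrizationData W 144)
    (hf : ∀ n : ℕ, ¬ 2 ∣ n → cuspCoeff D.f n = (ZMod.χ₄ n : ℂ) * cuspCoeff φ n)
    (hopt : ∀ z ∈ D.L.lattice, ∃ w ∈ periodLattice D.f, z = D.c * w) :
    |D.maninConstant| = 1 :=
  abs_maninConstant_eq_one_oneFortyFourB_of_cuspCoeff φ (EtaIdentitiesSeventyTwo.periodLatticeLe_seventyTwo φ hφ)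
    (cuspCoeff_eq_zero_seventyTwo φ hφ) W D hf hopt

/-- **`2 ∤ c ∧ 3 ∤ c` on `X₀(112)` for both twisted classes, with p3's `P`, `Q` (`exists_cuspForm_P56/Q56`) and the
coefficient identity as the ONLY inputs.** [cite: AgasheRibetStein2006, §§1–2] -/
theorem not_dvd_maninConstant_oneTwelve_of_eta (P Q : CuspForm (Gamma0 56) 2)
    (hP : ⇑P = etaQuotient 56 (expFn [(2, -1), (4, 3), (14, 3), (28, -1)]))
    (hQ : ⇑Q = etaQuotient 56 (expFn [(2, 3), (4, -1), (14, -1), (28, 3)]))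
    (W : WeierstrassCurve ℚ) [W.IsElliptic] [W.IsGloballyMinimal] (D : ModularParametrizationData W 112)
    (hf : (∀ n : ℕ, ¬ 2 ∣ n → cuspCoeff D.f n = (ZMod.χ₄ n : ℂ) * cuspCoeff (P - Q) n) ∨
      (∀ n : ℕ, ¬ 2 ∣ n → cuspCoeff D.f n = (ZMod.χ₄ n : ℂ) * cuspCoeff (P + Q) n))
    (hopt : ∀ z ∈ D.L.lattice, ∃ w ∈ periodLattice D.f, z = D.c * w) :
    ¬ (2 : ℤ) ∣ D.maninConstant ∧ ¬ (3 : ℤ) ∣ D.maninConstant := by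
  have hφ : ⇑(P - Q) = fun τ ↦ etaQuotient 56 (expFn [(2, -1), (4, 3), (14, 3), (28, -1)]) τ
      - etaQuotient 56 (expFn [(2, 3), (4, -1), (14, -1), (28, 3)]) τ := by
    rw [CuspForm.coe_sub, hP, hQ]; rfl
  have hψ : ⇑(P + Q) = fun τ ↦ etaQuotient 56 (expFn [(2, -1), (4, 3), (14, 3), (28, -1)]) τ
      + etaQuotient 56 (expFn [(2, 3), (4, -1), (14, -1), (28, 3)]) τ := by
    rw [CuspForm.coe_add, hP, hQ]; rfl
  have h : |D.maninConstant| = 1 := by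
    rcases hf with hf | hf
    · exact abs_maninConstant_eq_one_oneTwelveB_of_eta (P - Q) hφ W D hf hopt
    · exact abs_maninConstant_eq_one_oneTwelveA_of_eta (P + Q) hψ W D hf hopt
  refine ⟨fun h2 ↦ ?_, fun h3 ↦ ?_⟩
  · have := Int.le_of_dvd (by rw [h]; norm_num) ((dvd_abs _ _).mpr h2)
    rw [h] at this
    norm_num at this
  · have := Int.le_of_dvd (by rw [h]; norm_num) ((dvd_abs _ _).mpr h3)
    rw [h] at this
    norm_num at this

/-! ## §E  The form-identity interface: `hf` from a level-112 PINNING as a `charTwist` (the an-seat's kernel output) -/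

/-- **112a / 112b from a `charTwist` pinning (E-desc-245′)**: if the datum's newform IS the `χ₋₄`-twist of `P − Q` or of
`P + Q` in `S₂(Γ₀(112))` (a finite prefix identity in `M₂(Γ₀(112))` for the an-seat's kernel), then `2 ∤ c ∧ 3 ∤ c`.
[cite: AgasheRibetStein2006, §§1–2] -/
theorem not_dvd_maninConstant_oneTwelve_of_charTwist (P Q : CuspForm (Gamma0 56) 2)
    (hP : ⇑P = etaQuotient 56 (expFn [(2, -1), (4, 3), (14, 3), (28, -1)]))
    (hQ : ⇑Q = etaQuotient 56 (expFn [(2, 3), (4, -1), (14, -1), (28, 3)]))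
    (W : WeierstrassCurve ℚ) [W.IsElliptic] [W.IsGloballyMinimal] (D : ModularParametrizationData W 112)
    (hpin : D.f = charTwist 112 (⟨2, rfl⟩ : 56 ∣ 112) (⟨7, rfl⟩ : 4 ^ 2 ∣ 112) isQuadratic_χ₄_ringHomComp (P - Q) ∨
      D.f = charTwist 112 (⟨2, rfl⟩ : 56 ∣ 112) (⟨7, rfl⟩ : 4 ^ 2 ∣ 112) isQuadratic_χ₄_ringHomComp (P + Q))
    (hopt : ∀ z ∈ D.L.lattice, ∃ w ∈ periodLattice D.f, z = D.c * w) :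
    ¬ (2 : ℤ) ∣ D.maninConstant ∧ ¬ (3 : ℤ) ∣ D.maninConstant :=
  not_dvd_maninConstant_oneTwelve_of_eta P Q hP hQ W D
    (hpin.imp
      (fun h n _ ↦ by
        rw [h, cuspCoeff_charTwist 112 _ _ isQuadratic_χ₄_ringHomComp isPrimitive_χ₄_ringHomComp,
          χ₄_ringHomComp_apply_natCast])
      (fun h n _ ↦ by
        rw [h, cuspCoeff_charTwist 112 _ _ isQuadratic_χ₄_ringHomComp isPrimitive_χ₄_ringHomComp,
          χ₄_ringHomComp_apply_natCast]))
    hopt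

/-- **144b from a `charTwist` pinning**: `D.f = (φ₇₂) ⊗ χ₋₄` in `S₂(Γ₀(144))` ⟹ `|c(D)| = 1`. [cite: AgasheRibetStein2006, §§1–2] -/
theorem abs_maninConstant_eq_one_oneFortyFourB_of_charTwist (φ : CuspForm (Gamma0 72) 2)
    (hφ : ⇑φ = fun τ ↦ (2 / 3 : ℂ) * etaQuotient 72 (expFn [(2, -2), (4, 4), (6, 2)]) τ
        + (1 / 3 : ℂ) * etaQuotient 72 (expFn [(2, 4), (4, -2), (12, 2)]) τ)
    (W : WeierstrassCurve ℚ) [W.IsElliptic] [W.IsGloballyMinimal] (D : ModularParametrizationData W 144)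
    (hpin : D.f = charTwist 144 (⟨2, rfl⟩ : 72 ∣ 144) (⟨9, rfl⟩ : 4 ^ 2 ∣ 144) isQuadratic_χ₄_ringHomComp φ)
    (hopt : ∀ z ∈ D.L.lattice, ∃ w ∈ periodLattice D.f, z = D.c * w) :
    |D.maninConstant| = 1 :=
  abs_maninConstant_eq_one_oneFortyFourB_of_eta φ hφ W D
    (fun n _ ↦ by
      rw [hpin, cuspCoeff_charTwist 144 _ _ isQuadratic_χ₄_ringHomComp isPrimitive_χ₄_ringHomComp,
        χ₄_ringHomComp_apply_natCast])
    hopt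

/-! ## §F  128b / 128d DATUM-FREE: (I1) = p3's squeeze of `φ₁₂₈ₐ`, (I2) = η-parity; input = the `χ₈′`/`χ₈` coefficient identity -/

/-- **128b / 128d, datum-free (E-desc-241″):** for every `φa ∈ S₂(Γ₀(128))` with `⇑φa = φ₁₂₈ₐ` (p3's six-term
`η`-expression) and every lattice-optimal `X₀(128)`-datum whose odd coefficients are the `χ₈′`- or `χ₈`-twists of
those of `φa`: `2 ∤ c ∧ 3 ∤ c`. [cite: AgasheRibetStein2006, §§1–2] [cite: CremonaAlgorithms1997, Table 1 (128a–d)] -/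
theorem not_dvd_maninConstant_oneTwentyEightBD_of_eta (φa : CuspForm (Gamma0 128) 2)
    (hφa : ⇑φa = fun σ ↦ (-(4 * etaQuotient 128 (expFn [(8, 1), (16, 1), (32, -1), (64, 1), (128, 2)]) σ)
        - 2 * etaQuotient 128 (expFn [(8, 1), (16, 1), (32, -3), (64, 7), (128, -2)]) σ
        - 4 * etaQuotient 128 (expFn [(8, 1), (32, 1), (64, 2)]) σ
        + 2 * etaQuotient 128 (expFn [(8, 1), (16, -1), (32, 5), (64, -3), (128, 2)]) σ
        + etaQuotient 128 (expFn [(8, 1), (16, -1), (32, 3), (64, 3), (128, -2)]) σ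
        - 2 * etaQuotient 128 (expFn [(8, 1), (16, -2), (32, 7), (64, -2)]) σ))
    (W : WeierstrassCurve ℚ) [W.IsElliptic] [W.IsGloballyMinimal] (D : ModularParametrizationData W 128)
    (hf : (∀ n : ℕ, ¬ 2 ∣ n → cuspCoeff D.f n = (ZMod.χ₈' n : ℂ) * cuspCoeff φa n) ∨
      (∀ n : ℕ, ¬ 2 ∣ n → cuspCoeff D.f n = (ZMod.χ₈ n : ℂ) * cuspCoeff φa n))
    (hopt : ∀ z ∈ D.L.lattice, ∃ w ∈ periodLattice D.f, z = D.c * w) :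
    ¬ (2 : ℤ) ∣ D.maninConstant ∧ ¬ (3 : ℤ) ∣ D.maninConstant :=
  not_dvd_maninConstant_oneTwentyEightBD_of_cuspCoeff φa
    (EtaIdentitiesOneTwentyEightA.periodLatticeLe_oneTwentyEight φa hφa)
    (cuspCoeff_eq_zero_oneTwentyEightA φa hφa) W D hf hopt

end Summit.BirchSwinnertonDyer.BirchSwinnertonDyer.Theorems.ManinLocalTwoThree.TwistDefect

end
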